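import Summits.Ventures.GridStability.Bench.NE39KsDomIncl0
import Summits.Ventures.GridStability.Bench.NE39KsDomIncl1
import Summits.Ventures.GridStability.Bench.NE39KsDomIncl2
import Summits.Ventures.GridStability.Bench.NE39KsDomIncl3
import Summits.Ventures.GridStability.Bench.NE39KsDomIncl4
import Summits.Ventures.GridStability.Bench.NE39KsDomIncl5
import Summits.Ventures.GridStability.Bench.NE39KsDomIncl6
import Summits.Ventures.GridStability.Bench.NE39KsDomIncl7
import Summits.Ventures.GridStability.Bench.NE39KsDomIncl8
import Summits.Ventures.GridStability.Bench.NE39KsRoaLie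
import Summits.Ventures.GridStability.Bench.NE39KsVdotNegMain
import Summits.Ventures.GridStability.Lyapunov.CertificateSoundness
import Summits.Ventures.GridStability.Lyapunov.PolyRecastEval
import Mathlib.Analysis.Normed.Module.FiniteDimension
import HarnessLib

/-!
# «#73-roa» (recast half, PREPARATION): from the K-STREAM kernel set «G1.c-NE39-alg-deg2-K» + the nine level inclusions + kernel
# faithfulness to invariance of `{V ≤ γ ≤ 127} ∩ {h = 0}`, the bounds `2κₘ + νₘ² ≤ 1/2`, and `z(t) → 0` FOR THE RECAST
# MODEL M′ = `NE39.field (1/10)` (New England 10-machine classical, lossless pre-fault h12 network, synthetic λ = 1/10)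

Cell `gridfusion` (LADDER-GRIDFUSION rung G2.b / K-STREAM G2), seat gridfusion-lyap-2 (g2), OFFER «#73-roa» (HOME STATUS
2026-08-27T10:2xZ): the region-of-attraction packaging of ★-candidate #73 «G1.c-NE39-alg-deg2-K». INPUTS, all kernel facts
of the tree: (1) sos-5's K-STREAM Main `NE39KsVdotNeg_nonneg` (p520853): `p ≥ 0 on ∩ₘ{gₘ ≥ 0} ∩ {h = 0}`, `p` the
2 976-term claim literal; (2) `NE39KsRoaLie.vdot_linkK`: `p = −lieDeriv (NE39.field (1/10)) V − φ/50` (keyed link,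
`Lyapunov/PolyRecastKeyedLie.lean`) and the nine first integrals `hₘ`; (3) `NE39KsDomIncl0…8.domInclₘ`: on
`{V ≤ 127} ∩ {h = 0}`, `2κₘ + νₘ² ≤ 1/2` (B claim a191950b identities `dom_incl_m`, integer Gram lane); (4) lyap-1's bridge
`Lyapunov.certificate_invariance_tendsto_univ` (p460300) with `M = {h = 0}`, `W = φ/50`. Phase space `Fin 27 → ℝ` read as
the valuation `val z = SOS.vars (List.ofFn z)` (`val z k = z_k` for `k < 27`); variables `(σₘ, κₘ) = (val z (2m),
val z (2m+1))`, `νₘ = val z (18+m)`, m = 0 … 8 ↔ generators 1,3,4,5,6,7,8,9,10 relative to generator 2.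

This module: the phase space, the literals read on a valuation, the algebraic consequences (`LVz_le`, `Wz_nonneg`, `eq_zero_of_Wz`, `Wz_pos`) and the compactness of the certified piece; the calculus along solutions and the sentence `roa` are in `NE39KsRoa.lean`. STATEMENT there (`roa`): for every `0 < γ ≤ 127` and every solution `z` of `ż = F(z)` on `[0, ∞)` (Mathlib sense: continuous,
right derivative `F (z t)`, `F z i = ((NE39.field (1/10)).getD i []).eval (val z)`) with `z 0 ∈ M = {h₀ = … = h₈ = 0}` and
`V(z 0) ≤ γ`: `V(z t) ≤ γ` and `2κₘ(t) + νₘ(t)² ≤ 1/2` (all nine m) for all `t ≥ 0`, and `z t → 0`. Obligations discharged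
here: `LV ≤ −W` on `M ∩ {V ≤ 127}` (K-STREAM + level inclusions + the `hs`/`gs` literals read on a valuation), `W ≥ 0` on
`M` and `W = 0 ⇒ z = 0` (`2κₘ = σₘ² + κₘ²` on `M`), compactness of `{z ∈ M | V z ≤ 127}` (`‖z‖∞ ≤ 1`), the chain rule and
conservation of `M` (PolyRecast), `V(0) = 0`.

THREE COLUMNS (LADDER-GRIDFUSION). CERTIFIED (kernel, this file + its imports, axioms standard): the statement above
for the polynomial system M′. MODELLED: M′ = `NE39.field (1/10)` = `RecastData.relField NE39.preLossless (1/10)` (model-1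
p467599 / literals `RecastLiteralsNE39`), the relative-speed recast (reference = generator 2, H = 500 s) of the New England
10-machine 39-bus CLASSICAL model, PRE-fault network made LOSSLESS, h12 couplings, unit internal voltages (E6), printed
inertias, and the DECLARED SYNTHETIC uniform damping ratio `λ = D_i/M_i = 1/10` (printed `D = 0`) — MODEL-VALIDITY tokens
«MV-2 + MV-P(k = 8) + MV-λ(1/10) + MV-h12 + MV-E6» (model-2), data custody Row KS (model-4); a census / pipeline object
(«synthetic uniform damping on the lossless pre-fault New England reduction»), NOT a sentence about the printed system or
about any fault scenario. VALIDATED: nothing here (the SDP solves that located `V` — sos-4 A24 / j263956, j266124; sos-2 B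
j267116/j267119 — are provenance of the A/B rows, never the claim). No sentence of this file says a machine or a grid is
stable; «region of attraction» means: the stated set of initial conditions OF THE MODEL M′ is carried to the model's
equilibrium. The return to machine angles and speeds is the sibling `NE39KsRoaModel.lean`.
-/

namespace Summit.Ventures.GridStability.Bench.NE39Ks

open Set Filter Metric Topology Real
open Summit.Ventures.GridStability.Lyapunov Summit.Ventures.GridStability.Models
open Literature.Computation.Certificates Literature.Computation.Certificates.SOS

noncomputable section

/-! ### Recast phase space `Fin 27 → ℝ`, read as an `SOS` valuation -/

/-- The phase point as a valuation `ℕ → ℝ` of the certificate's 27 variables (`0` beyond). [folklore] -/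
def val (z : Fin 27 → ℝ) : ℕ → ℝ := vars (List.ofFn z)

/-- `val z k = z_k` for `k < 27`. [folklore] -/
theorem val_lt (z : Fin 27 → ℝ) {k : ℕ} (hk : k < 27) : val z k = z ⟨k, hk⟩ := PolyRecast.vars_ofFn_of_lt z hk

/-- The recast field of M′ on the phase space: component `i` = model-1's `(NE39.field (1/10)).getD i []` read on the valuation. MODELLED column. [folklore] -/
def F (z : Fin 27 → ℝ) : Fin 27 → ℝ := fun i => Poly.eval (val z) ((NE39.field (1 / 10)).getD i [])

/-- The certificate's `V` on the phase space. [folklore] -/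
def Vz (z : Fin 27 → ℝ) : ℝ := Poly.eval (val z) V_poly

/-- Its Lie derivative along `F`, in the form the K-STREAM claim delivers it: `V̇ = −(p + φ/50)`. [folklore] -/
def LVz (z : Fin 27 → ℝ) : ℝ := -Poly.eval (val z) Rp

/-- The certified dissipation rate `W = φ/50`, `φ = Σₘ (2κₘ + νₘ²)`. [folklore] -/
def Wz (z : Fin 27 → ℝ) : ℝ := (1 / 50) * Poly.eval (val z) phi_poly

/-- The recast constraint set `M = {h₀ = … = h₈ = 0}` (`hₘ = σₘ² + κₘ² − 2κₘ`). [folklore] -/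
def M : Set (Fin 27 → ℝ) := {z | ∀ h ∈ hsT, Poly.eval (val z) h = 0}

/-- The certificate's level `c = 127`. [folklore] -/
def level : ℝ := 127

/-! ### The literals read on a valuation `x : ℕ → ℝ` -/

/-- The nine circle identities, read on a valuation. [folklore] -/
theorem hs_eq (x : ℕ → ℝ) (hh : ∀ h ∈ hsT, Poly.eval x h = 0) :
    x 0 ^ 2 + x 1 ^ 2 - 2 * x 1 = 0 ∧
    x 2 ^ 2 + x 3 ^ 2 - 2 * x 3 = 0 ∧
    x 4 ^ 2 + x 5 ^ 2 - 2 * x 5 = 0 ∧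
    x 6 ^ 2 + x 7 ^ 2 - 2 * x 7 = 0 ∧
    x 8 ^ 2 + x 9 ^ 2 - 2 * x 9 = 0 ∧
    x 10 ^ 2 + x 11 ^ 2 - 2 * x 11 = 0 ∧
    x 12 ^ 2 + x 13 ^ 2 - 2 * x 13 = 0 ∧
    x 14 ^ 2 + x 15 ^ 2 - 2 * x 15 = 0 ∧
    x 16 ^ 2 + x 17 ^ 2 - 2 * x 17 = 0 := by
  refine ⟨?_, ?_, ?_, ?_, ?_, ?_, ?_, ?_, ?_⟩
  · have h := hh (hsT.getD 0 []) (by decide)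
    simp only [hsT, List.getD_cons_zero, Poly.eval_cons, Poly.eval_nil, Monomial.eval_eq, Monomial.evalFrom_cons, Monomial.evalFrom_nil, pow_zero, pow_one, one_mul, mul_one, add_zero] at h
    push_cast at h; linear_combination h
  · have h := hh (hsT.getD 1 []) (by decide)
    simp only [hsT, List.getD_cons_succ, List.getD_cons_zero, Poly.eval_cons, Poly.eval_nil, Monomial.eval_eq, Monomial.evalFrom_cons, Monomial.evalFrom_nil, pow_zero, pow_one, one_mul, mul_one, add_zero] at h
    push_cast at h; linear_combination h
  · have h := hh (hsT.getD 2 []) (by decide)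
    simp only [hsT, List.getD_cons_succ, List.getD_cons_zero, Poly.eval_cons, Poly.eval_nil, Monomial.eval_eq, Monomial.evalFrom_cons, Monomial.evalFrom_nil, pow_zero, pow_one, one_mul, mul_one, add_zero] at h
    push_cast at h; linear_combination h
  · have h := hh (hsT.getD 3 []) (by decide)
    simp only [hsT, List.getD_cons_succ, List.getD_cons_zero, Poly.eval_cons, Poly.eval_nil, Monomial.eval_eq, Monomial.evalFrom_cons, Monomial.evalFrom_nil, pow_zero, pow_one, one_mul, mul_one, add_zero] at h
    push_cast at h; linear_combination h
  · have h := hh (hsT.getD 4 []) (by decide)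
    simp only [hsT, List.getD_cons_succ, List.getD_cons_zero, Poly.eval_cons, Poly.eval_nil, Monomial.eval_eq, Monomial.evalFrom_cons, Monomial.evalFrom_nil, pow_zero, pow_one, one_mul, mul_one, add_zero] at h
    push_cast at h; linear_combination h
  · have h := hh (hsT.getD 5 []) (by decide)
    simp only [hsT, List.getD_cons_succ, List.getD_cons_zero, Poly.eval_cons, Poly.eval_nil, Monomial.eval_eq, Monomial.evalFrom_cons, Monomial.evalFrom_nil, pow_zero, pow_one, one_mul, mul_one, add_zero] at h
    push_cast at h; linear_combination h
  · have h := hh (hsT.getD 6 []) (by decide)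
    simp only [hsT, List.getD_cons_succ, List.getD_cons_zero, Poly.eval_cons, Poly.eval_nil, Monomial.eval_eq, Monomial.evalFrom_cons, Monomial.evalFrom_nil, pow_zero, pow_one, one_mul, mul_one, add_zero] at h
    push_cast at h; linear_combination h
  · have h := hh (hsT.getD 7 []) (by decide)
    simp only [hsT, List.getD_cons_succ, List.getD_cons_zero, Poly.eval_cons, Poly.eval_nil, Monomial.eval_eq, Monomial.evalFrom_cons, Monomial.evalFrom_nil, pow_zero, pow_one, one_mul, mul_one, add_zero] at h
    push_cast at h; linear_combination h
  · have h := hh (hsT.getD 8 []) (by decide)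
    simp only [hsT, List.getD_cons_succ, List.getD_cons_zero, Poly.eval_cons, Poly.eval_nil, Monomial.eval_eq, Monomial.evalFrom_cons, Monomial.evalFrom_nil, pow_zero, pow_one, one_mul, mul_one, add_zero] at h
    push_cast at h; linear_combination h

/-- Conversely, the nine identities give membership of the literal list `hsT`. [folklore] -/
theorem hs_of_eq (x : ℕ → ℝ)
    (e0 : x 0 ^ 2 + x 1 ^ 2 - 2 * x 1 = 0)
    (e1 : x 2 ^ 2 + x 3 ^ 2 - 2 * x 3 = 0)
    (e2 : x 4 ^ 2 + x 5 ^ 2 - 2 * x 5 = 0)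
    (e3 : x 6 ^ 2 + x 7 ^ 2 - 2 * x 7 = 0)
    (e4 : x 8 ^ 2 + x 9 ^ 2 - 2 * x 9 = 0)
    (e5 : x 10 ^ 2 + x 11 ^ 2 - 2 * x 11 = 0)
    (e6 : x 12 ^ 2 + x 13 ^ 2 - 2 * x 13 = 0)
    (e7 : x 14 ^ 2 + x 15 ^ 2 - 2 * x 15 = 0)
    (e8 : x 16 ^ 2 + x 17 ^ 2 - 2 * x 17 = 0) :
    ∀ h ∈ hsT, Poly.eval x h = 0 := by
  intro h hh
  simp only [hsT, List.mem_cons, List.not_mem_nil, or_false] at hh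
  rcases hh with rfl | rfl | rfl | rfl | rfl | rfl | rfl | rfl | rfl
  · simp only [Poly.eval_cons, Poly.eval_nil, Monomial.eval_eq, Monomial.evalFrom_cons, Monomial.evalFrom_nil, pow_zero, pow_one, one_mul, mul_one, add_zero]
    push_cast; linear_combination e0
  · simp only [Poly.eval_cons, Poly.eval_nil, Monomial.eval_eq, Monomial.evalFrom_cons, Monomial.evalFrom_nil, pow_zero, pow_one, one_mul, mul_one, add_zero]
    push_cast; linear_combination e1
  · simp only [Poly.eval_cons, Poly.eval_nil, Monomial.eval_eq, Monomial.evalFrom_cons, Monomial.evalFrom_nil, pow_zero, pow_one, one_mul, mul_one, add_zero]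
    push_cast; linear_combination e2
  · simp only [Poly.eval_cons, Poly.eval_nil, Monomial.eval_eq, Monomial.evalFrom_cons, Monomial.evalFrom_nil, pow_zero, pow_one, one_mul, mul_one, add_zero]
    push_cast; linear_combination e3
  · simp only [Poly.eval_cons, Poly.eval_nil, Monomial.eval_eq, Monomial.evalFrom_cons, Monomial.evalFrom_nil, pow_zero, pow_one, one_mul, mul_one, add_zero]
    push_cast; linear_combination e4
  · simp only [Poly.eval_cons, Poly.eval_nil, Monomial.eval_eq, Monomial.evalFrom_cons, Monomial.evalFrom_nil, pow_zero, pow_one, one_mul, mul_one, add_zero]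
    push_cast; linear_combination e5
  · simp only [Poly.eval_cons, Poly.eval_nil, Monomial.eval_eq, Monomial.evalFrom_cons, Monomial.evalFrom_nil, pow_zero, pow_one, one_mul, mul_one, add_zero]
    push_cast; linear_combination e6
  · simp only [Poly.eval_cons, Poly.eval_nil, Monomial.eval_eq, Monomial.evalFrom_cons, Monomial.evalFrom_nil, pow_zero, pow_one, one_mul, mul_one, add_zero]
    push_cast; linear_combination e7
  · simp only [Poly.eval_cons, Poly.eval_nil, Monomial.eval_eq, Monomial.evalFrom_cons, Monomial.evalFrom_nil, pow_zero, pow_one, one_mul, mul_one, add_zero]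
    push_cast; linear_combination e8

/-- The K-STREAM equality hypotheses `NE39KsVdotNeg_hs` (27-entry exponent vectors) from the nine identities. [folklore] -/
theorem ks_hs (x : ℕ → ℝ)
    (e0 : x 0 ^ 2 + x 1 ^ 2 - 2 * x 1 = 0)
    (e1 : x 2 ^ 2 + x 3 ^ 2 - 2 * x 3 = 0)
    (e2 : x 4 ^ 2 + x 5 ^ 2 - 2 * x 5 = 0)
    (e3 : x 6 ^ 2 + x 7 ^ 2 - 2 * x 7 = 0)
    (e4 : x 8 ^ 2 + x 9 ^ 2 - 2 * x 9 = 0)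
    (e5 : x 10 ^ 2 + x 11 ^ 2 - 2 * x 11 = 0)
    (e6 : x 12 ^ 2 + x 13 ^ 2 - 2 * x 13 = 0)
    (e7 : x 14 ^ 2 + x 15 ^ 2 - 2 * x 15 = 0)
    (e8 : x 16 ^ 2 + x 17 ^ 2 - 2 * x 17 = 0) :
    ∀ h ∈ NE39KsVdotNeg_hs, Poly.eval x h = 0 := by
  intro h hh
  simp only [NE39KsVdotNeg_hs, List.mem_cons, List.not_mem_nil, or_false] at hh
  rcases hh with rfl | rfl | rfl | rfl | rfl | rfl | rfl | rfl | rfl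
  · simp only [Poly.eval_cons, Poly.eval_nil, Monomial.eval_eq, Monomial.evalFrom_cons, Monomial.evalFrom_nil, pow_zero, pow_one, one_mul, mul_one, add_zero]
    push_cast; linear_combination e0
  · simp only [Poly.eval_cons, Poly.eval_nil, Monomial.eval_eq, Monomial.evalFrom_cons, Monomial.evalFrom_nil, pow_zero, pow_one, one_mul, mul_one, add_zero]
    push_cast; linear_combination e1
  · simp only [Poly.eval_cons, Poly.eval_nil, Monomial.eval_eq, Monomial.evalFrom_cons, Monomial.evalFrom_nil, pow_zero, pow_one, one_mul, mul_one, add_zero]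
    push_cast; linear_combination e2
  · simp only [Poly.eval_cons, Poly.eval_nil, Monomial.eval_eq, Monomial.evalFrom_cons, Monomial.evalFrom_nil, pow_zero, pow_one, one_mul, mul_one, add_zero]
    push_cast; linear_combination e3
  · simp only [Poly.eval_cons, Poly.eval_nil, Monomial.eval_eq, Monomial.evalFrom_cons, Monomial.evalFrom_nil, pow_zero, pow_one, one_mul, mul_one, add_zero]
    push_cast; linear_combination e4
  · simp only [Poly.eval_cons, Poly.eval_nil, Monomial.eval_eq, Monomial.evalFrom_cons, Monomial.evalFrom_nil, pow_zero, pow_one, one_mul, mul_one, add_zero]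
    push_cast; linear_combination e5
  · simp only [Poly.eval_cons, Poly.eval_nil, Monomial.eval_eq, Monomial.evalFrom_cons, Monomial.evalFrom_nil, pow_zero, pow_one, one_mul, mul_one, add_zero]
    push_cast; linear_combination e6
  · simp only [Poly.eval_cons, Poly.eval_nil, Monomial.eval_eq, Monomial.evalFrom_cons, Monomial.evalFrom_nil, pow_zero, pow_one, one_mul, mul_one, add_zero]
    push_cast; linear_combination e7
  · simp only [Poly.eval_cons, Poly.eval_nil, Monomial.eval_eq, Monomial.evalFrom_cons, Monomial.evalFrom_nil, pow_zero, pow_one, one_mul, mul_one, add_zero]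
    push_cast; linear_combination e8

/-- The K-STREAM inequality hypotheses `NE39KsVdotNeg_gs` from the nine level-inclusion bounds. [folklore] -/
theorem ks_gs (x : ℕ → ℝ)
    (d0 : 2 * x 1 + x 18 ^ 2 ≤ 1 / 2)
    (d1 : 2 * x 3 + x 19 ^ 2 ≤ 1 / 2)
    (d2 : 2 * x 5 + x 20 ^ 2 ≤ 1 / 2)
    (d3 : 2 * x 7 + x 21 ^ 2 ≤ 1 / 2)
    (d4 : 2 * x 9 + x 22 ^ 2 ≤ 1 / 2)
    (d5 : 2 * x 11 + x 23 ^ 2 ≤ 1 / 2)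
    (d6 : 2 * x 13 + x 24 ^ 2 ≤ 1 / 2)
    (d7 : 2 * x 15 + x 25 ^ 2 ≤ 1 / 2)
    (d8 : 2 * x 17 + x 26 ^ 2 ≤ 1 / 2) :
    ∀ g ∈ NE39KsVdotNeg_gs, 0 ≤ Poly.eval x g := by
  intro g hg
  simp only [NE39KsVdotNeg_gs, List.mem_cons, List.not_mem_nil, or_false] at hg
  rcases hg with rfl | rfl | rfl | rfl | rfl | rfl | rfl | rfl | rfl
  · simp only [Poly.eval_cons, Poly.eval_nil, Monomial.eval_eq, Monomial.evalFrom_cons, Monomial.evalFrom_nil, pow_zero, pow_one, one_mul, mul_one, add_zero]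
    push_cast; linarith
  · simp only [Poly.eval_cons, Poly.eval_nil, Monomial.eval_eq, Monomial.evalFrom_cons, Monomial.evalFrom_nil, pow_zero, pow_one, one_mul, mul_one, add_zero]
    push_cast; linarith
  · simp only [Poly.eval_cons, Poly.eval_nil, Monomial.eval_eq, Monomial.evalFrom_cons, Monomial.evalFrom_nil, pow_zero, pow_one, one_mul, mul_one, add_zero]
    push_cast; linarith
  · simp only [Poly.eval_cons, Poly.eval_nil, Monomial.eval_eq, Monomial.evalFrom_cons, Monomial.evalFrom_nil, pow_zero, pow_one, one_mul, mul_one, add_zero]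
    push_cast; linarith
  · simp only [Poly.eval_cons, Poly.eval_nil, Monomial.eval_eq, Monomial.evalFrom_cons, Monomial.evalFrom_nil, pow_zero, pow_one, one_mul, mul_one, add_zero]
    push_cast; linarith
  · simp only [Poly.eval_cons, Poly.eval_nil, Monomial.eval_eq, Monomial.evalFrom_cons, Monomial.evalFrom_nil, pow_zero, pow_one, one_mul, mul_one, add_zero]
    push_cast; linarith
  · simp only [Poly.eval_cons, Poly.eval_nil, Monomial.eval_eq, Monomial.evalFrom_cons, Monomial.evalFrom_nil, pow_zero, pow_one, one_mul, mul_one, add_zero]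
    push_cast; linarith
  · simp only [Poly.eval_cons, Poly.eval_nil, Monomial.eval_eq, Monomial.evalFrom_cons, Monomial.evalFrom_nil, pow_zero, pow_one, one_mul, mul_one, add_zero]
    push_cast; linarith
  · simp only [Poly.eval_cons, Poly.eval_nil, Monomial.eval_eq, Monomial.evalFrom_cons, Monomial.evalFrom_nil, pow_zero, pow_one, one_mul, mul_one, add_zero]
    push_cast; linarith

/-- `φ` read on a valuation. [folklore] -/
theorem eval_phi (x : ℕ → ℝ) : Poly.eval x phi_poly =
    (2 * x 1 + x 18 ^ 2) + (2 * x 3 + x 19 ^ 2) + (2 * x 5 + x 20 ^ 2) + (2 * x 7 + x 21 ^ 2) + (2 * x 9 + x 22 ^ 2) + (2 * x 11 + x 23 ^ 2) + (2 * x 13 + x 24 ^ 2) + (2 * x 15 + x 25 ^ 2) + (2 * x 17 + x 26 ^ 2) := by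
  simp only [phi_poly, Poly.eval_cons, Poly.eval_nil, Monomial.eval_eq, Monomial.evalFrom_cons, Monomial.evalFrom_nil, pow_zero, pow_one, one_mul, mul_one, add_zero]
  push_cast; ring

/-- `Rp = p ++ φ/50` read on a valuation. [folklore] -/
theorem eval_Rp (x : ℕ → ℝ) : Poly.eval x Rp = Poly.eval x NE39KsVdotNeg_p + (1 / 50) * Poly.eval x phi_poly := by
  rw [Rp, Poly.eval_append, Poly.eval_smul]; push_cast; ring

/-! ### Algebraic consequences of the certified identities -/

/-- **Dissipation inequality in bridge form** on `M ∩ {V ≤ 127}`: `LV ≤ −W` — the K-STREAM inequality `p ≥ 0`, its domain hypotheses discharged by the nine level inclusions. CERTIFIED inputs: `NE39KsVdotNeg_nonneg`, `domIncl0…8`. [folklore] -/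
theorem LVz_le {z : Fin 27 → ℝ} (hz : z ∈ M) (hV : Vz z ≤ level) : LVz z ≤ -Wz z := by
  have hV' : Poly.eval (val z) V_poly ≤ 127 := hV
  obtain ⟨e0, e1, e2, e3, e4, e5, e6, e7, e8⟩ := hs_eq (val z) hz
  have d0 := domIncl0 (val z) hV' hz
  have d1 := domIncl1 (val z) hV' hz
  have d2 := domIncl2 (val z) hV' hz
  have d3 := domIncl3 (val z) hV' hz
  have d4 := domIncl4 (val z) hV' hz
  have d5 := domIncl5 (val z) hV' hz
  have d6 := domIncl6 (val z) hV' hz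
  have d7 := domIncl7 (val z) hV' hz
  have d8 := domIncl8 (val z) hV' hz
  have hp := NE39KsVdotNeg_nonneg (val z) (ks_gs (val z) d0 d1 d2 d3 d4 d5 d6 d7 d8) (ks_hs (val z) e0 e1 e2 e3 e4 e5 e6 e7 e8)
  simp only [LVz, Wz, eval_Rp]
  linarith

/-- On `M`, `φ` is a sum of squares: `φ = Σₘ (σₘ² + κₘ² + νₘ²)` (`2κₘ = σₘ² + κₘ²`). [folklore] -/
theorem eval_phi_of_mem (x : ℕ → ℝ) (hh : ∀ h ∈ hsT, Poly.eval x h = 0) :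
    Poly.eval x phi_poly = (x 0 ^ 2 + x 1 ^ 2 + x 18 ^ 2) + (x 2 ^ 2 + x 3 ^ 2 + x 19 ^ 2) + (x 4 ^ 2 + x 5 ^ 2 + x 20 ^ 2) + (x 6 ^ 2 + x 7 ^ 2 + x 21 ^ 2) + (x 8 ^ 2 + x 9 ^ 2 + x 22 ^ 2) + (x 10 ^ 2 + x 11 ^ 2 + x 23 ^ 2) + (x 12 ^ 2 + x 13 ^ 2 + x 24 ^ 2) + (x 14 ^ 2 + x 15 ^ 2 + x 25 ^ 2) + (x 16 ^ 2 + x 17 ^ 2 + x 26 ^ 2) := by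
  obtain ⟨e0, e1, e2, e3, e4, e5, e6, e7, e8⟩ := hs_eq x hh
  rw [eval_phi]
  linear_combination (-1 : ℝ) * (e0 + e1 + e2 + e3 + e4 + e5 + e6 + e7 + e8)

/-- `W ≥ 0` on `M`. [folklore] -/
theorem Wz_nonneg {z : Fin 27 → ℝ} (hz : z ∈ M) : 0 ≤ Wz z := by
  unfold Wz; rw [eval_phi_of_mem (val z) hz]; positivity

/-- A vanishing sum of the 27 squares forces every coordinate to vanish. [folklore] -/
theorem sumsq_eq_zero (x : ℕ → ℝ) (h0 : (x 0 ^ 2 + x 1 ^ 2 + x 18 ^ 2) + (x 2 ^ 2 + x 3 ^ 2 + x 19 ^ 2) + (x 4 ^ 2 + x 5 ^ 2 + x 20 ^ 2) + (x 6 ^ 2 + x 7 ^ 2 + x 21 ^ 2) + (x 8 ^ 2 + x 9 ^ 2 + x 22 ^ 2) + (x 10 ^ 2 + x 11 ^ 2 + x 23 ^ 2) + (x 12 ^ 2 + x 13 ^ 2 + x 24 ^ 2) + (x 14 ^ 2 + x 15 ^ 2 + x 25 ^ 2) + (x 16 ^ 2 + x 17 ^ 2 + x 26 ^ 2) = 0)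 :
    ∀ k < 27, x k = 0 := by
  have q0 : x 0 = 0 := (pow_eq_zero_iff two_ne_zero).1 (by linarith [sq_nonneg (x 0), sq_nonneg (x 1), sq_nonneg (x 2), sq_nonneg (x 3), sq_nonneg (x 4), sq_nonneg (x 5), sq_nonneg (x 6), sq_nonneg (x 7), sq_nonneg (x 8), sq_nonneg (x 9), sq_nonneg (x 10), sq_nonneg (x 11), sq_nonneg (x 12), sq_nonneg (x 13), sq_nonneg (x 14), sq_nonneg (x 15), sq_nonneg (x 16), sq_nonneg (x 17), sq_nonneg (x 18), sq_nonneg (x 19), sq_nonneg (x 20), sq_nonneg (x 21), sq_nonneg (x 22), sq_nonneg (x 23), sq_nonneg (x 24), sq_nonneg (x 25), sq_nonneg (x 26)])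
  have q1 : x 1 = 0 := (pow_eq_zero_iff two_ne_zero).1 (by linarith [sq_nonneg (x 0), sq_nonneg (x 1), sq_nonneg (x 2), sq_nonneg (x 3), sq_nonneg (x 4), sq_nonneg (x 5), sq_nonneg (x 6), sq_nonneg (x 7), sq_nonneg (x 8), sq_nonneg (x 9), sq_nonneg (x 10), sq_nonneg (x 11), sq_nonneg (x 12), sq_nonneg (x 13), sq_nonneg (x 14), sq_nonneg (x 15), sq_nonneg (x 16), sq_nonneg (x 17), sq_nonneg (x 18), sq_nonneg (x 19), sq_nonneg (x 20), sq_nonneg (x 21), sq_nonneg (x 22), sq_nonneg (x 23), sq_nonneg (x 24), sq_nonneg (x 25), sq_nonneg (x 26)])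
  have q2 : x 2 = 0 := (pow_eq_zero_iff two_ne_zero).1 (by linarith [sq_nonneg (x 0), sq_nonneg (x 1), sq_nonneg (x 2), sq_nonneg (x 3), sq_nonneg (x 4), sq_nonneg (x 5), sq_nonneg (x 6), sq_nonneg (x 7), sq_nonneg (x 8), sq_nonneg (x 9), sq_nonneg (x 10), sq_nonneg (x 11), sq_nonneg (x 12), sq_nonneg (x 13), sq_nonneg (x 14), sq_nonneg (x 15), sq_nonneg (x 16), sq_nonneg (x 17), sq_nonneg (x 18), sq_nonneg (x 19), sq_nonneg (x 20), sq_nonneg (x 21), sq_nonneg (x 22), sq_nonneg (x 23), sq_nonneg (x 24), sq_nonneg (x 25), sq_nonneg (x 26)])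
  have q3 : x 3 = 0 := (pow_eq_zero_iff two_ne_zero).1 (by linarith [sq_nonneg (x 0), sq_nonneg (x 1), sq_nonneg (x 2), sq_nonneg (x 3), sq_nonneg (x 4), sq_nonneg (x 5), sq_nonneg (x 6), sq_nonneg (x 7), sq_nonneg (x 8), sq_nonneg (x 9), sq_nonneg (x 10), sq_nonneg (x 11), sq_nonneg (x 12), sq_nonneg (x 13), sq_nonneg (x 14), sq_nonneg (x 15), sq_nonneg (x 16), sq_nonneg (x 17), sq_nonneg (x 18), sq_nonneg (x 19), sq_nonneg (x 20), sq_nonneg (x 21), sq_nonneg (x 22), sq_nonneg (x 23), sq_nonneg (x 24), sq_nonneg (x 25), sq_nonneg (x 26)])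
  have q4 : x 4 = 0 := (pow_eq_zero_iff two_ne_zero).1 (by linarith [sq_nonneg (x 0), sq_nonneg (x 1), sq_nonneg (x 2), sq_nonneg (x 3), sq_nonneg (x 4), sq_nonneg (x 5), sq_nonneg (x 6), sq_nonneg (x 7), sq_nonneg (x 8), sq_nonneg (x 9), sq_nonneg (x 10), sq_nonneg (x 11), sq_nonneg (x 12), sq_nonneg (x 13), sq_nonneg (x 14), sq_nonneg (x 15), sq_nonneg (x 16), sq_nonneg (x 17), sq_nonneg (x 18), sq_nonneg (x 19), sq_nonneg (x 20), sq_nonneg (x 21), sq_nonneg (x 22), sq_nonneg (x 23), sq_nonneg (x 24), sq_nonneg (x 25), sq_nonneg (x 26)])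
  have q5 : x 5 = 0 := (pow_eq_zero_iff two_ne_zero).1 (by linarith [sq_nonneg (x 0), sq_nonneg (x 1), sq_nonneg (x 2), sq_nonneg (x 3), sq_nonneg (x 4), sq_nonneg (x 5), sq_nonneg (x 6), sq_nonneg (x 7), sq_nonneg (x 8), sq_nonneg (x 9), sq_nonneg (x 10), sq_nonneg (x 11), sq_nonneg (x 12), sq_nonneg (x 13), sq_nonneg (x 14), sq_nonneg (x 15), sq_nonneg (x 16), sq_nonneg (x 17), sq_nonneg (x 18), sq_nonneg (x 19), sq_nonneg (x 20), sq_nonneg (x 21), sq_nonneg (x 22), sq_nonneg (x 23), sq_nonneg (x 24), sq_nonneg (x 25), sq_nonneg (x 26)])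
  have q6 : x 6 = 0 := (pow_eq_zero_iff two_ne_zero).1 (by linarith [sq_nonneg (x 0), sq_nonneg (x 1), sq_nonneg (x 2), sq_nonneg (x 3), sq_nonneg (x 4), sq_nonneg (x 5), sq_nonneg (x 6), sq_nonneg (x 7), sq_nonneg (x 8), sq_nonneg (x 9), sq_nonneg (x 10), sq_nonneg (x 11), sq_nonneg (x 12), sq_nonneg (x 13), sq_nonneg (x 14), sq_nonneg (x 15), sq_nonneg (x 16), sq_nonneg (x 17), sq_nonneg (x 18), sq_nonneg (x 19), sq_nonneg (x 20), sq_nonneg (x 21), sq_nonneg (x 22), sq_nonneg (x 23), sq_nonneg (x 24), sq_nonneg (x 25), sq_nonneg (x 26)])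
  have q7 : x 7 = 0 := (pow_eq_zero_iff two_ne_zero).1 (by linarith [sq_nonneg (x 0), sq_nonneg (x 1), sq_nonneg (x 2), sq_nonneg (x 3), sq_nonneg (x 4), sq_nonneg (x 5), sq_nonneg (x 6), sq_nonneg (x 7), sq_nonneg (x 8), sq_nonneg (x 9), sq_nonneg (x 10), sq_nonneg (x 11), sq_nonneg (x 12), sq_nonneg (x 13), sq_nonneg (x 14), sq_nonneg (x 15), sq_nonneg (x 16), sq_nonneg (x 17), sq_nonneg (x 18), sq_nonneg (x 19), sq_nonneg (x 20), sq_nonneg (x 21), sq_nonneg (x 22), sq_nonneg (x 23), sq_nonneg (x 24), sq_nonneg (x 25), sq_nonneg (x 26)])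
  have q8 : x 8 = 0 := (pow_eq_zero_iff two_ne_zero).1 (by linarith [sq_nonneg (x 0), sq_nonneg (x 1), sq_nonneg (x 2), sq_nonneg (x 3), sq_nonneg (x 4), sq_nonneg (x 5), sq_nonneg (x 6), sq_nonneg (x 7), sq_nonneg (x 8), sq_nonneg (x 9), sq_nonneg (x 10), sq_nonneg (x 11), sq_nonneg (x 12), sq_nonneg (x 13), sq_nonneg (x 14), sq_nonneg (x 15), sq_nonneg (x 16), sq_nonneg (x 17), sq_nonneg (x 18), sq_nonneg (x 19), sq_nonneg (x 20), sq_nonneg (x 21), sq_nonneg (x 22), sq_nonneg (x 23), sq_nonneg (x 24), sq_nonneg (x 25), sq_nonneg (x 26)])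
  have q9 : x 9 = 0 := (pow_eq_zero_iff two_ne_zero).1 (by linarith [sq_nonneg (x 0), sq_nonneg (x 1), sq_nonneg (x 2), sq_nonneg (x 3), sq_nonneg (x 4), sq_nonneg (x 5), sq_nonneg (x 6), sq_nonneg (x 7), sq_nonneg (x 8), sq_nonneg (x 9), sq_nonneg (x 10), sq_nonneg (x 11), sq_nonneg (x 12), sq_nonneg (x 13), sq_nonneg (x 14), sq_nonneg (x 15), sq_nonneg (x 16), sq_nonneg (x 17), sq_nonneg (x 18), sq_nonneg (x 19), sq_nonneg (x 20), sq_nonneg (x 21), sq_nonneg (x 22), sq_nonneg (x 23), sq_nonneg (x 24), sq_nonneg (x 25), sq_nonneg (x 26)])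
  have q10 : x 10 = 0 := (pow_eq_zero_iff two_ne_zero).1 (by linarith [sq_nonneg (x 0), sq_nonneg (x 1), sq_nonneg (x 2), sq_nonneg (x 3), sq_nonneg (x 4), sq_nonneg (x 5), sq_nonneg (x 6), sq_nonneg (x 7), sq_nonneg (x 8), sq_nonneg (x 9), sq_nonneg (x 10), sq_nonneg (x 11), sq_nonneg (x 12), sq_nonneg (x 13), sq_nonneg (x 14), sq_nonneg (x 15), sq_nonneg (x 16), sq_nonneg (x 17), sq_nonneg (x 18), sq_nonneg (x 19), sq_nonneg (x 20), sq_nonneg (x 21), sq_nonneg (x 22), sq_nonneg (x 23), sq_nonneg (x 24), sq_nonneg (x 25), sq_nonneg (x 26)])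
  have q11 : x 11 = 0 := (pow_eq_zero_iff two_ne_zero).1 (by linarith [sq_nonneg (x 0), sq_nonneg (x 1), sq_nonneg (x 2), sq_nonneg (x 3), sq_nonneg (x 4), sq_nonneg (x 5), sq_nonneg (x 6), sq_nonneg (x 7), sq_nonneg (x 8), sq_nonneg (x 9), sq_nonneg (x 10), sq_nonneg (x 11), sq_nonneg (x 12), sq_nonneg (x 13), sq_nonneg (x 14), sq_nonneg (x 15), sq_nonneg (x 16), sq_nonneg (x 17), sq_nonneg (x 18), sq_nonneg (x 19), sq_nonneg (x 20), sq_nonneg (x 21), sq_nonneg (x 22), sq_nonneg (x 23), sq_nonneg (x 24), sq_nonneg (x 25), sq_nonneg (x 26)])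
  have q12 : x 12 = 0 := (pow_eq_zero_iff two_ne_zero).1 (by linarith [sq_nonneg (x 0), sq_nonneg (x 1), sq_nonneg (x 2), sq_nonneg (x 3), sq_nonneg (x 4), sq_nonneg (x 5), sq_nonneg (x 6), sq_nonneg (x 7), sq_nonneg (x 8), sq_nonneg (x 9), sq_nonneg (x 10), sq_nonneg (x 11), sq_nonneg (x 12), sq_nonneg (x 13), sq_nonneg (x 14), sq_nonneg (x 15), sq_nonneg (x 16), sq_nonneg (x 17), sq_nonneg (x 18), sq_nonneg (x 19), sq_nonneg (x 20), sq_nonneg (x 21), sq_nonneg (x 22), sq_nonneg (x 23), sq_nonneg (x 24), sq_nonneg (x 25), sq_nonneg (x 26)])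
  have q13 : x 13 = 0 := (pow_eq_zero_iff two_ne_zero).1 (by linarith [sq_nonneg (x 0), sq_nonneg (x 1), sq_nonneg (x 2), sq_nonneg (x 3), sq_nonneg (x 4), sq_nonneg (x 5), sq_nonneg (x 6), sq_nonneg (x 7), sq_nonneg (x 8), sq_nonneg (x 9), sq_nonneg (x 10), sq_nonneg (x 11), sq_nonneg (x 12), sq_nonneg (x 13), sq_nonneg (x 14), sq_nonneg (x 15), sq_nonneg (x 16), sq_nonneg (x 17), sq_nonneg (x 18), sq_nonneg (x 19), sq_nonneg (x 20), sq_nonneg (x 21), sq_nonneg (x 22), sq_nonneg (x 23), sq_nonneg (x 24), sq_nonneg (x 25), sq_nonneg (x 26)])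
  have q14 : x 14 = 0 := (pow_eq_zero_iff two_ne_zero).1 (by linarith [sq_nonneg (x 0), sq_nonneg (x 1), sq_nonneg (x 2), sq_nonneg (x 3), sq_nonneg (x 4), sq_nonneg (x 5), sq_nonneg (x 6), sq_nonneg (x 7), sq_nonneg (x 8), sq_nonneg (x 9), sq_nonneg (x 10), sq_nonneg (x 11), sq_nonneg (x 12), sq_nonneg (x 13), sq_nonneg (x 14), sq_nonneg (x 15), sq_nonneg (x 16), sq_nonneg (x 17), sq_nonneg (x 18), sq_nonneg (x 19), sq_nonneg (x 20), sq_nonneg (x 21), sq_nonneg (x 22), sq_nonneg (x 23), sq_nonneg (x 24), sq_nonneg (x 25), sq_nonneg (x 26)])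
  have q15 : x 15 = 0 := (pow_eq_zero_iff two_ne_zero).1 (by linarith [sq_nonneg (x 0), sq_nonneg (x 1), sq_nonneg (x 2), sq_nonneg (x 3), sq_nonneg (x 4), sq_nonneg (x 5), sq_nonneg (x 6), sq_nonneg (x 7), sq_nonneg (x 8), sq_nonneg (x 9), sq_nonneg (x 10), sq_nonneg (x 11), sq_nonneg (x 12), sq_nonneg (x 13), sq_nonneg (x 14), sq_nonneg (x 15), sq_nonneg (x 16), sq_nonneg (x 17), sq_nonneg (x 18), sq_nonneg (x 19), sq_nonneg (x 20), sq_nonneg (x 21), sq_nonneg (x 22), sq_nonneg (x 23), sq_nonneg (x 24), sq_nonneg (x 25), sq_nonneg (x 26)])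
  have q16 : x 16 = 0 := (pow_eq_zero_iff two_ne_zero).1 (by linarith [sq_nonneg (x 0), sq_nonneg (x 1), sq_nonneg (x 2), sq_nonneg (x 3), sq_nonneg (x 4), sq_nonneg (x 5), sq_nonneg (x 6), sq_nonneg (x 7), sq_nonneg (x 8), sq_nonneg (x 9), sq_nonneg (x 10), sq_nonneg (x 11), sq_nonneg (x 12), sq_nonneg (x 13), sq_nonneg (x 14), sq_nonneg (x 15), sq_nonneg (x 16), sq_nonneg (x 17), sq_nonneg (x 18), sq_nonneg (x 19), sq_nonneg (x 20), sq_nonneg (x 21), sq_nonneg (x 22), sq_nonneg (x 23), sq_nonneg (x 24), sq_nonneg (x 25), sq_nonneg (x 26)])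
  have q17 : x 17 = 0 := (pow_eq_zero_iff two_ne_zero).1 (by linarith [sq_nonneg (x 0), sq_nonneg (x 1), sq_nonneg (x 2), sq_nonneg (x 3), sq_nonneg (x 4), sq_nonneg (x 5), sq_nonneg (x 6), sq_nonneg (x 7), sq_nonneg (x 8), sq_nonneg (x 9), sq_nonneg (x 10), sq_nonneg (x 11), sq_nonneg (x 12), sq_nonneg (x 13), sq_nonneg (x 14), sq_nonneg (x 15), sq_nonneg (x 16), sq_nonneg (x 17), sq_nonneg (x 18), sq_nonneg (x 19), sq_nonneg (x 20), sq_nonneg (x 21), sq_nonneg (x 22), sq_nonneg (x 23), sq_nonneg (x 24), sq_nonneg (x 25), sq_nonneg (x 26)])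
  have q18 : x 18 = 0 := (pow_eq_zero_iff two_ne_zero).1 (by linarith [sq_nonneg (x 0), sq_nonneg (x 1), sq_nonneg (x 2), sq_nonneg (x 3), sq_nonneg (x 4), sq_nonneg (x 5), sq_nonneg (x 6), sq_nonneg (x 7), sq_nonneg (x 8), sq_nonneg (x 9), sq_nonneg (x 10), sq_nonneg (x 11), sq_nonneg (x 12), sq_nonneg (x 13), sq_nonneg (x 14), sq_nonneg (x 15), sq_nonneg (x 16), sq_nonneg (x 17), sq_nonneg (x 18), sq_nonneg (x 19), sq_nonneg (x 20), sq_nonneg (x 21), sq_nonneg (x 22), sq_nonneg (x 23), sq_nonneg (x 24), sq_nonneg (x 25), sq_nonneg (x 26)])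
  have q19 : x 19 = 0 := (pow_eq_zero_iff two_ne_zero).1 (by linarith [sq_nonneg (x 0), sq_nonneg (x 1), sq_nonneg (x 2), sq_nonneg (x 3), sq_nonneg (x 4), sq_nonneg (x 5), sq_nonneg (x 6), sq_nonneg (x 7), sq_nonneg (x 8), sq_nonneg (x 9), sq_nonneg (x 10), sq_nonneg (x 11), sq_nonneg (x 12), sq_nonneg (x 13), sq_nonneg (x 14), sq_nonneg (x 15), sq_nonneg (x 16), sq_nonneg (x 17), sq_nonneg (x 18), sq_nonneg (x 19), sq_nonneg (x 20), sq_nonneg (x 21), sq_nonneg (x 22), sq_nonneg (x 23), sq_nonneg (x 24), sq_nonneg (x 25), sq_nonneg (x 26)])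
  have q20 : x 20 = 0 := (pow_eq_zero_iff two_ne_zero).1 (by linarith [sq_nonneg (x 0), sq_nonneg (x 1), sq_nonneg (x 2), sq_nonneg (x 3), sq_nonneg (x 4), sq_nonneg (x 5), sq_nonneg (x 6), sq_nonneg (x 7), sq_nonneg (x 8), sq_nonneg (x 9), sq_nonneg (x 10), sq_nonneg (x 11), sq_nonneg (x 12), sq_nonneg (x 13), sq_nonneg (x 14), sq_nonneg (x 15), sq_nonneg (x 16), sq_nonneg (x 17), sq_nonneg (x 18), sq_nonneg (x 19), sq_nonneg (x 20), sq_nonneg (x 21), sq_nonneg (x 22), sq_nonneg (x 23), sq_nonneg (x 24), sq_nonneg (x 25), sq_nonneg (x 26)])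
  have q21 : x 21 = 0 := (pow_eq_zero_iff two_ne_zero).1 (by linarith [sq_nonneg (x 0), sq_nonneg (x 1), sq_nonneg (x 2), sq_nonneg (x 3), sq_nonneg (x 4), sq_nonneg (x 5), sq_nonneg (x 6), sq_nonneg (x 7), sq_nonneg (x 8), sq_nonneg (x 9), sq_nonneg (x 10), sq_nonneg (x 11), sq_nonneg (x 12), sq_nonneg (x 13), sq_nonneg (x 14), sq_nonneg (x 15), sq_nonneg (x 16), sq_nonneg (x 17), sq_nonneg (x 18), sq_nonneg (x 19), sq_nonneg (x 20), sq_nonneg (x 21), sq_nonneg (x 22), sq_nonneg (x 23), sq_nonneg (x 24), sq_nonneg (x 25), sq_nonneg (x 26)])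
  have q22 : x 22 = 0 := (pow_eq_zero_iff two_ne_zero).1 (by linarith [sq_nonneg (x 0), sq_nonneg (x 1), sq_nonneg (x 2), sq_nonneg (x 3), sq_nonneg (x 4), sq_nonneg (x 5), sq_nonneg (x 6), sq_nonneg (x 7), sq_nonneg (x 8), sq_nonneg (x 9), sq_nonneg (x 10), sq_nonneg (x 11), sq_nonneg (x 12), sq_nonneg (x 13), sq_nonneg (x 14), sq_nonneg (x 15), sq_nonneg (x 16), sq_nonneg (x 17), sq_nonneg (x 18), sq_nonneg (x 19), sq_nonneg (x 20), sq_nonneg (x 21), sq_nonneg (x 22), sq_nonneg (x 23), sq_nonneg (x 24), sq_nonneg (x 25), sq_nonneg (x 26)])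
  have q23 : x 23 = 0 := (pow_eq_zero_iff two_ne_zero).1 (by linarith [sq_nonneg (x 0), sq_nonneg (x 1), sq_nonneg (x 2), sq_nonneg (x 3), sq_nonneg (x 4), sq_nonneg (x 5), sq_nonneg (x 6), sq_nonneg (x 7), sq_nonneg (x 8), sq_nonneg (x 9), sq_nonneg (x 10), sq_nonneg (x 11), sq_nonneg (x 12), sq_nonneg (x 13), sq_nonneg (x 14), sq_nonneg (x 15), sq_nonneg (x 16), sq_nonneg (x 17), sq_nonneg (x 18), sq_nonneg (x 19), sq_nonneg (x 20), sq_nonneg (x 21), sq_nonneg (x 22), sq_nonneg (x 23), sq_nonneg (x 24), sq_nonneg (x 25), sq_nonneg (x 26)])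
  have q24 : x 24 = 0 := (pow_eq_zero_iff two_ne_zero).1 (by linarith [sq_nonneg (x 0), sq_nonneg (x 1), sq_nonneg (x 2), sq_nonneg (x 3), sq_nonneg (x 4), sq_nonneg (x 5), sq_nonneg (x 6), sq_nonneg (x 7), sq_nonneg (x 8), sq_nonneg (x 9), sq_nonneg (x 10), sq_nonneg (x 11), sq_nonneg (x 12), sq_nonneg (x 13), sq_nonneg (x 14), sq_nonneg (x 15), sq_nonneg (x 16), sq_nonneg (x 17), sq_nonneg (x 18), sq_nonneg (x 19), sq_nonneg (x 20), sq_nonneg (x 21), sq_nonneg (x 22), sq_nonneg (x 23), sq_nonneg (x 24), sq_nonneg (x 25), sq_nonneg (x 26)])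
  have q25 : x 25 = 0 := (pow_eq_zero_iff two_ne_zero).1 (by linarith [sq_nonneg (x 0), sq_nonneg (x 1), sq_nonneg (x 2), sq_nonneg (x 3), sq_nonneg (x 4), sq_nonneg (x 5), sq_nonneg (x 6), sq_nonneg (x 7), sq_nonneg (x 8), sq_nonneg (x 9), sq_nonneg (x 10), sq_nonneg (x 11), sq_nonneg (x 12), sq_nonneg (x 13), sq_nonneg (x 14), sq_nonneg (x 15), sq_nonneg (x 16), sq_nonneg (x 17), sq_nonneg (x 18), sq_nonneg (x 19), sq_nonneg (x 20), sq_nonneg (x 21), sq_nonneg (x 22), sq_nonneg (x 23), sq_nonneg (x 24), sq_nonneg (x 25), sq_nonneg (x 26)])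
  have q26 : x 26 = 0 := (pow_eq_zero_iff two_ne_zero).1 (by linarith [sq_nonneg (x 0), sq_nonneg (x 1), sq_nonneg (x 2), sq_nonneg (x 3), sq_nonneg (x 4), sq_nonneg (x 5), sq_nonneg (x 6), sq_nonneg (x 7), sq_nonneg (x 8), sq_nonneg (x 9), sq_nonneg (x 10), sq_nonneg (x 11), sq_nonneg (x 12), sq_nonneg (x 13), sq_nonneg (x 14), sq_nonneg (x 15), sq_nonneg (x 16), sq_nonneg (x 17), sq_nonneg (x 18), sq_nonneg (x 19), sq_nonneg (x 20), sq_nonneg (x 21), sq_nonneg (x 22), sq_nonneg (x 23), sq_nonneg (x 24), sq_nonneg (x 25), sq_nonneg (x 26)])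
  intro k hk
  interval_cases k <;> assumption

/-- On `M`, `W z = 0` only at the origin. [folklore] -/
theorem eq_zero_of_Wz {z : Fin 27 → ℝ} (hz : z ∈ M) (hW : Wz z = 0) : z = 0 := by
  have h0 : Poly.eval (val z) phi_poly = 0 := by unfold Wz at hW; linarith
  rw [eval_phi_of_mem (val z) hz] at h0
  have hk := sumsq_eq_zero (val z) h0
  funext i
  rw [← show val z i.val = z i from val_lt z i.isLt]
  exact hk i.val i.isLt

/-- `W > 0` on `M ∩ {V = γ}` for `γ > 0` (`V(0) = 0`). [folklore] -/
theorem Wz_pos {γ : ℝ} (hγ : 0 < γ) {z : Fin 27 → ℝ} (hz : z ∈ M) (hV : Vz z = γ) : 0 < Wz z := by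
  rcases (Wz_nonneg hz).lt_or_eq with h | h
  · exact h
  · exfalso
    have hz0 := eq_zero_of_Wz hz h.symm
    subst hz0
    have : Vz 0 = 0 := PolyRecast.eval_ofFn_zero_of_all V_poly (by decide +kernel)
    linarith

/-- The origin lies on `M`. [folklore] -/
theorem zero_mem_M : (0 : Fin 27 → ℝ) ∈ M := by
  intro h hh
  simp only [hsT, List.mem_cons, List.not_mem_nil, or_false] at hh
  rcases hh with rfl | rfl | rfl | rfl | rfl | rfl | rfl | rfl | rfl <;> exact PolyRecast.eval_ofFn_zero_of_all _ (by decide)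

/-- `M` is closed. [folklore] -/
theorem isClosed_M : IsClosed M := by
  have : M = ⋂ h ∈ hsT, {z : Fin 27 → ℝ | Poly.eval (val z) h = 0} := by ext z; simp [M]
  rw [this]
  exact isClosed_biInter fun h _ => isClosed_eq (PolyRecast.continuous_eval_ofFn h) continuous_const

/-- One relative angle/speed triple `(σ, κ, ν)` on the certified piece: `σ² + κ² = 2κ` and `2κ + ν² ≤ 1/2` give `|σ|, |κ|, |ν| ≤ 1`. [folklore] -/
theorem triple_bound (a b c : ℝ) (e : a ^ 2 + b ^ 2 - 2 * b = 0) (d : 2 * b + c ^ 2 ≤ 1 / 2) :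
    |a| ≤ 1 ∧ |b| ≤ 1 ∧ |c| ≤ 1 := by
  have hb0 : 0 ≤ b := by linarith [sq_nonneg a, sq_nonneg b]
  have hb1 : b ≤ 1 / 4 := by linarith [sq_nonneg c]
  have ha : a ^ 2 ≤ 1 := by linarith [sq_nonneg b, sq_nonneg c]
  have hc : c ^ 2 ≤ 1 := by linarith
  exact ⟨(sq_le_one_iff_abs_le_one a).1 ha, abs_le.2 ⟨by linarith, by linarith⟩, (sq_le_one_iff_abs_le_one c).1 hc⟩

/-- Coordinate bounds on the certified piece: on `M ∩ {V ≤ 127}` every variable has absolute value `≤ 1`. [folklore] -/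
theorem abs_val_le {z : Fin 27 → ℝ} (hz : z ∈ M) (hV : Vz z ≤ level) : ∀ k < 27, |val z k| ≤ 1 := by
  have hV' : Poly.eval (val z) V_poly ≤ 127 := hV
  obtain ⟨e0, e1, e2, e3, e4, e5, e6, e7, e8⟩ := hs_eq (val z) hz
  have t0 := triple_bound _ _ _ e0 (domIncl0 (val z) hV' hz)
  have t1 := triple_bound _ _ _ e1 (domIncl1 (val z) hV' hz)
  have t2 := triple_bound _ _ _ e2 (domIncl2 (val z) hV' hz)
  have t3 := triple_bound _ _ _ e3 (domIncl3 (val z) hV' hz)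
  have t4 := triple_bound _ _ _ e4 (domIncl4 (val z) hV' hz)
  have t5 := triple_bound _ _ _ e5 (domIncl5 (val z) hV' hz)
  have t6 := triple_bound _ _ _ e6 (domIncl6 (val z) hV' hz)
  have t7 := triple_bound _ _ _ e7 (domIncl7 (val z) hV' hz)
  have t8 := triple_bound _ _ _ e8 (domIncl8 (val z) hV' hz)
  intro k hk
  interval_cases k
  · exact t0.1
  · exact t0.2.1
  · exact t1.1
  · exact t1.2.1
  · exact t2.1
  · exact t2.2.1
  · exact t3.1
  · exact t3.2.1
  · exact t4.1
  · exact t4.2.1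
  · exact t5.1
  · exact t5.2.1
  · exact t6.1
  · exact t6.2.1
  · exact t7.1
  · exact t7.2.1
  · exact t8.1
  · exact t8.2.1
  · exact t0.2.2
  · exact t1.2.2
  · exact t2.2.2
  · exact t3.2.2
  · exact t4.2.2
  · exact t5.2.2
  · exact t6.2.2
  · exact t7.2.2
  · exact t8.2.2

/-- **Compactness of the certified piece** `S = {z ∈ M | V z ≤ 127}` (closed; `‖z‖∞ ≤ 1`). [folklore] -/
theorem isCompact_S : IsCompact {z ∈ M | Vz z ≤ level} := by
  have hVc : Continuous Vz := PolyRecast.continuous_eval_ofFn V_poly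
  have h := isCompact_sublevel_of_norm_le (D := univ) (c := level) (R := (1 : ℝ)) isClosed_M
    isClosed_univ hVc.continuousOn ?_
  · rwa [inter_univ] at h
  rintro z ⟨hz, -⟩ hV
  refine (pi_norm_le_iff_of_nonneg (by norm_num)).2 fun i => ?_
  rw [Real.norm_eq_abs, ← show val z i.val = z i from val_lt z i.isLt]
  exact abs_val_le hz hV i.val i.isLt

end

end Summit.Ventures.GridStability.Bench.NE39Ks
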